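import Mathlib
import HarnessLib
import Summits.HubbardSuperconductivity.HubbardSuperconductivity.Theorems.KLProgrammeC4aAbsBubbleDominator
import Summits.HubbardSuperconductivity.HubbardSuperconductivity.Theorems.KLProgrammeC4aAbsBubbleThresholds

/-!
# Route `KLProgramme` — crux C4a, S3 brick (B4)/(B5) «(B4)-DIRECT-PACK», part 10: the ∃-FORM — for every loop piece and weight ceiling there is a θ-, ρ-, lo-free
# logarithmic dominator of the absolute pp bubble (all thresholds and cell counts chosen internally)

Cell `gate-hubbard-kl`, seat hubbard-kl-k3c3-p3 (g27; row «implicit-function / monotonicity route for μ(n)»).  Located brick for the (C)-closer lane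
hubbard-kl-c4a-1 (stub (C) `stub_twoLeg_curvature` of `KLRegimeEngineV17F2`, stmt-HubbardSuperconductivity-20437), memo B4-DIRECT-PACK.md §3b.

**`exists_absBubble_dominator`**: from clause (i) of `FrameOK` in the Sizes binder shape (`GeomConstants (frameLevel μ K) Kc r₀ g₀ w`, `K₁, K₂ > 0`), for every loop piece
`[a,b]` and weight ceiling `W ≥ 0` there are numbers `hi > 0` (`hi < r`) and `K₀, P ≥ 0`, `M` such that for EVERY level offset `|ρ| < r`, base angle `θ`, infrared end
`0 < lo ≤ hi`, envelope floors `t e ≥ e` and weight `0 ≤ wt ≤ W` on `[lo,hi]`, and every tube angle with `‖ϑ − π‖_𝕋 > 0`: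
`∫_{lo..hi} wt(e)·(∫_{[a,b]} dx/max(t e, |e_K(S_{ρϑθ} − Φ(e,x+θ))|)) de ≤ K₀ + P·log⁺(M/‖ϑ − π‖_𝕋)`.
(Part 9's witnesses + Archimedean cell counts + part 8b; `exists_absBubble_dominator_ph` is the ph twin with `‖ϑ‖_𝕋`.)  With part 8a this is an admissible `k = 0` dominator of `CoMovingJetsL1` whose angular integral is
`≤ 2π(K₀ + P(1 + log⁺(M/π)))`; the levels above `hi` are covered by `level_loop_le_large_levels`.  Nothing asserts (C), K3 or superconductivity.
-/

noncomputable section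

namespace Summit.HubbardSuperconductivity.HubbardSuperconductivity.Theorems.C4a

set_option linter.dupNamespace false -- summit = problem name (single-conjunct summit), D-0017

open Real Set MeasureTheory
open Literature.MathematicalPhysics.QuantumLattice Literature.MathematicalPhysics.QuantumLattice.BandSectorCounting
open Literature.MathematicalPhysics.QuantumLattice.FermiRG
open Summit.HubbardSuperconductivity.HubbardSuperconductivity.Theorems.KLRegimeSplit
open Summit.HubbardSuperconductivity.HubbardSuperconductivity.Theorems.DispersionFlow
open Summit.HubbardSuperconductivity.HubbardSuperconductivity.Theorems.PerturbedFermiCurve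

/-- Archimedean cell count: for `c > 0` there is `N : ℕ` with `x ≤ N·c`. -/
theorem exists_nat_mul_ge (x : ℝ) {c : ℝ} (hc : 0 < c) : ∃ N : ℕ, x ≤ N * c := by
  refine ⟨⌈x / c⌉₊, ?_⟩
  have h := Nat.le_ceil (x / c)
  calc x = x / c * c := by field_simp
    _ ≤ ⌈x / c⌉₊ * c := mul_le_mul_of_nonneg_right h hc.le

section Sizes

variable {K : TrigPolyC4v} {A : ℝ} (hA : ∀ p : Momentum, ∀ j ≤ 2, ‖iteratedFDeriv ℝ j (frameShift K) p‖ ≤ A) (hA20 : A ≤ 1 / 20)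
  (hd : klCurveD ≤ (bandBounds (show (-4 : ℝ) < -1.1 by norm_num) (show (-1.1 : ℝ) ≤ -0.1 by norm_num)
    (show (-0.1 : ℝ) < 0 by norm_num)).Dtmin - 2 * A)
  {μ r : ℝ} (hr : 0 < r) (hlo : (-1.1 : ℝ) < μ - r - A) (hhi : μ + r + A < -0.1)
  {A₃ A₄ : ℝ} (hA₃ : ∀ p : Momentum, ‖iteratedFDeriv ℝ 3 (frameShift K) p‖ ≤ A₃)
  (hA₄ : ∀ p : Momentum, ‖iteratedFDeriv ℝ 4 (frameShift K) p‖ ≤ A₄)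
  {K₁ K₂ K₃ : ℝ} (hK₁ : ∀ p : Momentum, ‖fderiv ℝ (frameLevel μ K) p‖ ≤ K₁) (hK₂ : ∀ p : Momentum, ‖iteratedFDeriv ℝ 2 (frameLevel μ K) p‖ ≤ K₂)
  (hK₃ : ∀ p : Momentum, ‖iteratedFDeriv ℝ 3 (frameLevel μ K) p‖ ≤ K₃)
include hA hA20 hd hr hlo hhi hA₃ hA₄ hK₁ hK₂ hK₃

/-- **THE ∃-FORM OF THE pp DOMINATOR**: for every loop piece `[a,b]` and weight ceiling `W ≥ 0` there are `hi ∈ (0, r)`, `K₀, P ≥ 0` and `M` with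
`F(ϑ;ρ,θ) ≤ K₀ + P·log⁺(M/‖ϑ − π‖_𝕋)` for all `|ρ| < r`, `θ`, `0 < lo ≤ hi`, floors `t ≥ id`, weights `0 ≤ wt ≤ W`, `‖ϑ − π‖_𝕋 > 0`. -/
theorem exists_absBubble_dominator {Kc r₀ g₀ w : ℝ} (hG : GeomConstants (frameLevel μ K) Kc r₀ g₀ w) (hK₁0 : 0 < K₁) (hK₂0 : 0 < K₂)
    {a b W : ℝ} (hab : a ≤ b) (hW : 0 ≤ W) :
    ∃ hi K₀ P M : ℝ, 0 < hi ∧ hi < r ∧ 0 ≤ K₀ ∧ 0 ≤ P ∧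
      ∀ (ρ θ lo : ℝ) (t wt : ℝ → ℝ), |ρ| < r → 0 < lo → lo ≤ hi → (∀ e ∈ Icc lo hi, e ≤ t e) → (∀ e ∈ Icc lo hi, 0 ≤ wt e) →
        (∀ e ∈ Icc lo hi, wt e ≤ W) → ∀ ϑ : ℝ, 0 < torusDist (ϑ - π) →
          (∫ e in lo..hi, wt e * ∫ x in Icc a b, (max (t e) |frameLevel μ K (pairSumPath μ K ρ ϑ θ 0 - levelPoint μ K e (x + θ))|)⁻¹) ≤
            K₀ + P * log⁺ (M / torusDist (ϑ - π)) := by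
  obtain ⟨c₀, c₁, sC, d₁, κ, hi, hc₀, hc₁, hsC, hd₁, hκ, hhi0, hhir₀, hX, hwinC, hwinC', hhirC, hs₀, hs₀', hhirT, hsmall⟩ :=
    exists_absBubble_thresholds hA hd hr hA₃ hK₁ hK₂ hK₃ hG
  -- cell counts
  obtain ⟨NC, hNC⟩ := exists_nat_mul_ge ((b - a) * (4 * (K₂ * msD A₃ A₄ 1))) hc₀
  obtain ⟨NT₁, hNT₁⟩ := exists_nat_mul_ge ((b - a) * (4 * (K₁ * msD A₃ A₄ 1))) hκ
  obtain ⟨NT₂, hNT₂⟩ := exists_nat_mul_ge ((b - a) * (4 * (K₂ * msD A₃ A₄ 1 ^ 2 + K₁ * msD A₃ A₄ 2))) hd₁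
  set NT := max NT₁ NT₂ with hNTdef
  have hNT : (b - a) * (4 * (K₁ * msD A₃ A₄ 1)) ≤ NT * κ :=
    hNT₁.trans (mul_le_mul_of_nonneg_right (by exact_mod_cast le_max_left NT₁ NT₂) hκ.le)
  have hNT' : (b - a) * (4 * (K₂ * msD A₃ A₄ 1 ^ 2 + K₁ * msD A₃ A₄ 2)) ≤ NT * d₁ :=
    hNT₂.trans (mul_le_mul_of_nonneg_right (by exact_mod_cast le_max_right NT₁ NT₂) hd₁.le)
  have hhir : hi < r := by have := mul_pos hc₀ hsC; linarith
  have hupos := (bandBounds (show (-4 : ℝ) < -1.1 by norm_num) (show (-1.1 : ℝ) ≤ -0.1 by norm_num) (show (-0.1 : ℝ) < 0 by norm_num)).umin_pos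
  have hwpos := hG.wmin_pos
  have hposlog : ∀ y : ℝ, 0 ≤ log⁺ y := fun y => Real.posLog_nonneg
  refine ⟨hi,
    W * ((4 * (b - a) / κ + 2 * (NT * (4 / d₁))) * (κ / 2) +
          2 * (12 * NT / Real.sqrt (w * (bandBounds (show (-4 : ℝ) < -1.1 by norm_num) (show (-1.1 : ℝ) ≤ -0.1 by norm_num)
            (show (-0.1 : ℝ) < 0 by norm_num)).umin ^ 2)) * Real.sqrt (κ / 2) + (b - a) * log⁺ (hi / (κ / 2))) +
      W * (2 * (b - a) + 2 * (NC * c₀ / c₁)),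
    W * (b - a),
    π * hi / (c₀ * (bandBounds (show (-4 : ℝ) < -1.1 by norm_num) (show (-1.1 : ℝ) ≤ -0.1 by norm_num) (show (-0.1 : ℝ) < 0 by norm_num)).umin),
    hhi0, hhir, ?_, mul_nonneg hW (by linarith), ?_⟩
  · have := hposlog (hi / (κ / 2))
    positivity
  · intro ρ θ lo t wt hρ hlo0 hlohi ht hw0 hw ϑ hϑ
    exact absBubble_partnerBand_le_posLog hA hA20 hd hr hlo hhi hA₃ hA₄ hK₁ hK₂ hK₃ hG hK₁0 hK₂0 hρ hab hlo0 hlohi hhir₀ hc₀ hc₁ hX hwinC hwinC' hhirC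
      hNC hd₁ hκ hs₀ hs₀' hhirT hsmall hNT hNT' ht hW hw0 hw hϑ

/-- **THE ∃-FORM OF THE ph DOMINATOR** (partner band `e_K(Φ(e,x+θ) − D_{ρϑθ})`, forward configuration = Cooper point): same with `‖ϑ‖_𝕋`. -/
theorem exists_absBubble_dominator_ph {Kc r₀ g₀ w : ℝ} (hG : GeomConstants (frameLevel μ K) Kc r₀ g₀ w) (hK₁0 : 0 < K₁) (hK₂0 : 0 < K₂)
    {a b W : ℝ} (hab : a ≤ b) (hW : 0 ≤ W) :
    ∃ hi K₀ P M : ℝ, 0 < hi ∧ hi < r ∧ 0 ≤ K₀ ∧ 0 ≤ P ∧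
      ∀ (ρ θ lo : ℝ) (t wt : ℝ → ℝ), |ρ| < r → 0 < lo → lo ≤ hi → (∀ e ∈ Icc lo hi, e ≤ t e) → (∀ e ∈ Icc lo hi, 0 ≤ wt e) →
        (∀ e ∈ Icc lo hi, wt e ≤ W) → ∀ ϑ : ℝ, 0 < torusDist ϑ →
          (∫ e in lo..hi, wt e * ∫ x in Icc a b, (max (t e) |frameLevel μ K (levelPoint μ K e (x + θ) - pairDiffPath μ K ρ ϑ θ 0)|)⁻¹) ≤
            K₀ + P * log⁺ (M / torusDist ϑ) := by
  obtain ⟨c₀, c₁, sC, d₁, κ, hi, hc₀, hc₁, hsC, hd₁, hκ, hhi0, hhir₀, hX, hwinC, hwinC', hhirC, hs₀, hs₀', hhirT, hsmall⟩ :=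
    exists_absBubble_thresholds hA hd hr hA₃ hK₁ hK₂ hK₃ hG
  -- cell counts
  obtain ⟨NC, hNC⟩ := exists_nat_mul_ge ((b - a) * (4 * (K₂ * msD A₃ A₄ 1))) hc₀
  obtain ⟨NT₁, hNT₁⟩ := exists_nat_mul_ge ((b - a) * (4 * (K₁ * msD A₃ A₄ 1))) hκ
  obtain ⟨NT₂, hNT₂⟩ := exists_nat_mul_ge ((b - a) * (4 * (K₂ * msD A₃ A₄ 1 ^ 2 + K₁ * msD A₃ A₄ 2))) hd₁
  set NT := max NT₁ NT₂ with hNTdef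
  have hNT : (b - a) * (4 * (K₁ * msD A₃ A₄ 1)) ≤ NT * κ :=
    hNT₁.trans (mul_le_mul_of_nonneg_right (by exact_mod_cast le_max_left NT₁ NT₂) hκ.le)
  have hNT' : (b - a) * (4 * (K₂ * msD A₃ A₄ 1 ^ 2 + K₁ * msD A₃ A₄ 2)) ≤ NT * d₁ :=
    hNT₂.trans (mul_le_mul_of_nonneg_right (by exact_mod_cast le_max_right NT₁ NT₂) hd₁.le)
  have hhir : hi < r := by have := mul_pos hc₀ hsC; linarith
  have hupos := (bandBounds (show (-4 : ℝ) < -1.1 by norm_num) (show (-1.1 : ℝ) ≤ -0.1 by norm_num) (show (-0.1 : ℝ) < 0 by norm_num)).umin_pos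
  have hwpos := hG.wmin_pos
  have hposlog : ∀ y : ℝ, 0 ≤ log⁺ y := fun y => Real.posLog_nonneg
  refine ⟨hi,
    W * ((4 * (b - a) / κ + 2 * (NT * (4 / d₁))) * (κ / 2) +
          2 * (12 * NT / Real.sqrt (w * (bandBounds (show (-4 : ℝ) < -1.1 by norm_num) (show (-1.1 : ℝ) ≤ -0.1 by norm_num)
            (show (-0.1 : ℝ) < 0 by norm_num)).umin ^ 2)) * Real.sqrt (κ / 2) + (b - a) * log⁺ (hi / (κ / 2))) +
      W * (2 * (b - a) + 2 * (NC * c₀ / c₁)),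
    W * (b - a),
    π * hi / (c₀ * (bandBounds (show (-4 : ℝ) < -1.1 by norm_num) (show (-1.1 : ℝ) ≤ -0.1 by norm_num) (show (-0.1 : ℝ) < 0 by norm_num)).umin),
    hhi0, hhir, ?_, mul_nonneg hW (by linarith), ?_⟩
  · have := hposlog (hi / (κ / 2))
    positivity
  · intro ρ θ lo t wt hρ hlo0 hlohi ht hw0 hw ϑ hϑ
    exact absBubble_partnerBand_ph_le_posLog hA hA20 hd hr hlo hhi hA₃ hA₄ hK₁ hK₂ hK₃ hG hK₁0 hK₂0 hρ hab hlo0 hlohi hhir₀ hc₀ hc₁ hX hwinC hwinC' hhirC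
      hNC hd₁ hκ hs₀ hs₀' hhirT hsmall hNT hNT' ht hW hw0 hw hϑ

end Sizes

end Summit.HubbardSuperconductivity.HubbardSuperconductivity.Theorems.C4a

end
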